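import Summits.CriticalPhenomena.PercolationContinuityZ3.Theorems.Transplant.SkelFrmFromBParamsSlotsT
import Summits.CriticalPhenomena.PercolationContinuityZ3.Theorems.Transplant.SkelFrmBParamsSlotsT
import Summits.CriticalPhenomena.PercolationContinuityZ3.Theorems.Transplant.SkelNegBParamsSlotsT
import Summits.CriticalPhenomena.PercolationContinuityZ3.Theorems.Transplant.SkelFrmFromBParamsFineSizeA
import Summits.CriticalPhenomena.PercolationContinuityZ3.Theorems.Transplant.SkelFrmBParamsFineSizeA
import Summits.CriticalPhenomena.PercolationContinuityZ3.Theorems.Transplant.SkelNegBParamsFineSizeA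
import Summits.CriticalPhenomena.PercolationContinuityZ3.Theorems.Transplant.SkelFrmFrom1SlotTypes
import Summits.CriticalPhenomena.PercolationContinuityZ3.Theorems.Transplant.SkelFrm1SlotTypes
import Summits.CriticalPhenomena.PercolationContinuityZ3.Theorems.Transplant.SkelFrmFrom1ParamsPO
import Summits.CriticalPhenomena.PercolationContinuityZ3.Theorems.Transplant.SkelFrm1ParamsPO
import Summits.CriticalPhenomena.PercolationContinuityZ3.Theorems.Transplant.SkelFrmFrom1ParamsLBL
import Summits.CriticalPhenomena.PercolationContinuityZ3.Theorems.Transplant.SkelFrm1ParamsLBL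
import Summits.CriticalPhenomena.PercolationContinuityZ3.Theorems.Transplant.SkelFrmFromBParamsKitA
import Summits.CriticalPhenomena.PercolationContinuityZ3.Theorems.Transplant.SkelFrmBParamsKitA
import Summits.CriticalPhenomena.PercolationContinuityZ3.Theorems.Transplant.SkelFrmFromBParamsKitS
import Summits.CriticalPhenomena.PercolationContinuityZ3.Theorems.Transplant.SkelFrmBParamsKitS
import Summits.CriticalPhenomena.PercolationContinuityZ3.Theorems.Transplant.SkelFrmFrom1ParamsLF
import Summits.CriticalPhenomena.PercolationContinuityZ3.Theorems.Transplant.SkelFrm1ParamsLF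
import Summits.CriticalPhenomena.PercolationContinuityZ3.Theorems.Transplant.SkelFrmFrom1ParamsLO
import Summits.CriticalPhenomena.PercolationContinuityZ3.Theorems.Transplant.SkelFrm1ParamsLO
import Summits.CriticalPhenomena.PercolationContinuityZ3.Theorems.Transplant.SkelFrmFromBParamsLF
import Summits.CriticalPhenomena.PercolationContinuityZ3.Theorems.Transplant.SkelFrmBParamsLF
import Summits.CriticalPhenomena.PercolationContinuityZ3.Theorems.Transplant.SkelFrmFromBParamsFineSize
import Summits.CriticalPhenomena.PercolationContinuityZ3.Theorems.Transplant.SkelFrmBParamsFineSize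
import Summits.CriticalPhenomena.PercolationContinuityZ3.Theorems.Transplant.SkelFrmFromBParamsLFA
import Summits.CriticalPhenomena.PercolationContinuityZ3.Theorems.Transplant.SkelFrmBParamsLFA
import Summits.CriticalPhenomena.PercolationContinuityZ3.Theorems.Transplant.SkelFrmFromBParamsLO
import Summits.CriticalPhenomena.PercolationContinuityZ3.Theorems.Transplant.SkelFrmBParamsLO
import Summits.CriticalPhenomena.PercolationContinuityZ3.Theorems.Transplant.SkelFrmFromBParamsB
import Summits.CriticalPhenomena.PercolationContinuityZ3.Theorems.Transplant.SkelFrmBParamsB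
import Summits.CriticalPhenomena.PercolationContinuityZ3.Theorems.Transplant.SkelFrmFromBParamsSlotsR
import Summits.CriticalPhenomena.PercolationContinuityZ3.Theorems.Transplant.SkelFrmBParamsSlotsR
import Summits.CriticalPhenomena.PercolationContinuityZ3.Theorems.Transplant.SkelFrmFromBParamsSlotsRS
import Summits.CriticalPhenomena.PercolationContinuityZ3.Theorems.Transplant.SkelFrmBParamsSlotsRS
import Summits.CriticalPhenomena.PercolationContinuityZ3.Theorems.Transplant.SkelFrmFromBParamsSlots
import Summits.CriticalPhenomena.PercolationContinuityZ3.Theorems.Transplant.SkelFrmBParamsSlots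
import Summits.CriticalPhenomena.PercolationContinuityZ3.Theorems.Transplant.SkelFrmFromBParamsSched
import Summits.CriticalPhenomena.PercolationContinuityZ3.Theorems.Transplant.SkelFrmBParamsSched
import Summits.CriticalPhenomena.PercolationContinuityZ3.Theorems.Transplant.SkelFrmFromBParamsReachFC
import Summits.CriticalPhenomena.PercolationContinuityZ3.Theorems.Transplant.SkelFrmBParamsReachFC
import Summits.CriticalPhenomena.PercolationContinuityZ3.Theorems.Transplant.SkelNegBParamsSlotsTA
import Summits.CriticalPhenomena.PercolationContinuityZ3.Theorems.Transplant.PlanarSkeletonFrmFromDefs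
import Summits.CriticalPhenomena.PercolationContinuityZ3.Theorems.Transplant.PlanarSkeletonFrmDefs
import Summits.CriticalPhenomena.PercolationContinuityZ3.Theorems.Transplant.SkelPhiStepIDataNS
import HarnessLib
import Summits.CriticalPhenomena.PercolationContinuityZ3.Theorems.Transplant.SkelFrmBParamsSlotsTA
/-!
# U-WAVE PORT (RULING D-U, lead g21 2026-08-26; WAVE-U-MANIFEST v3.1 row «SkelFrmBParamsSlotsTA» ↦ «SkelFrmFromBParamsSlotsTA») of the tree module
# `Transplant/SkelFrmBParamsSlotsTA` onto the carrier `PlanarSkeletonFrmFrom` (frames only, cylinders connected from width `ℓ₀` on)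

ORIGINAL TITLE: N2 (frames-only node `SamePDropOfSkeletonFrmFrom₁`, OPEN) params column over `PlanarSkeletonFrm` — (ζ″) ledger, shape (B′) of record ((R-14)):

builds on p205010 (kernel theorem, internal audit signed; external expert review pending) — nothing in this file uses p205010; NOTHING is claimed about the
OPEN node U `SamePDropOfSkeletonFrmFrom₁` (nor U_s / the end state).  Lane `prim-bschramm`, seat `prim-bschramm-stmt` gen 26 (port pen, RULING M-11 family P-stmt; tool = p3-g26's port_u.py of record, registry-driven inputs); helper file
(`--supports stmt-CriticalPhenomena-4575 --as helper`).  PORT RULES r1–r4 of RULING D-U: declaration order and proof texts are those of the original,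
byte-identical except (i) the carrier token `PlanarSkeletonFrm ↦ PlanarSkeletonFrmFrom` (binders, `namespace`/`end` lines, qualified names of twinned
declarations), (ii) carrier-FREE declarations of the original (φ-level `Skelφ…` blocks and namespace-only arithmetic residents) are NOT re-declared —
this file imports the original and `export`s the twin-free residents (POLICY T / treatment (m1)); residents whose statement mentions a twinned
constant are copied, (iii) every carrier-binding declaration keeps its explicit binder `(Φ : PlanarSkeletonFrmFrom G)` in its own signature (r2).  Docstrings and citations are the original's.
-/

noncomputable section

open scoped Classical

namespace Summit.CriticalPhenomena.PercolationContinuityZ3.Theorems.Transplant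

namespace PlanarSkeletonFrmFrom

namespace NegB

namespace KS

open Literature.Probability.Percolation Literature.Probability.LatticeModels SimpleGraph
open SkelConc (Consts)
open Skelφ.StepI (DataN)
open Neg

/-! ## §1 The (ζ′) cells under a box floor -/

section Cells

/-- **TRUE (ζ′) CELL SIZES UNDER A BOX FLOOR**: for ANY `r` with `4K(r+2) ≤ M_L`, `Kq·(6r + 11) ≤ s₀` and `Kq·(14r + 27) ≤ s₁` (from `true_size₀A/₁A`:
`M_L + 1 ≤ 23·(s₀+2)`, `≤ 11·(s₁+2)`, and `K = 40·Kq`). [folklore] -/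
theorem sA_ge_of_floor (κ : Consts) {V : Type} [DecidableEq V] [Countable V] {G : SimpleGraph V} [G.LocallyFinite] (Φ : PlanarSkeletonFrmFrom G) (t : V) (p : unitInterval) (D : Skelφ.StepI.DataNS V) (g : ℕ) (f : ℕ) (hN : EqNumL κ Φ t p D g f) (hκ : (hL κ Φ t p D g f).natAbs ≤ 10 * nL κ Φ t p D g f) {r : ℕ} (hr : 4 * Neg.K κ * (r + 2) ≤ ML κ Φ t p D g) :
    (Neg.Kq κ : ℤ) * (6 * (r : ℤ) + 11) ≤ (((fcellsA κ Φ t p D g f).s 0 : ℕ) : ℤ) ∧ (Neg.Kq κ : ℤ) * (14 * (r : ℤ) + 27) ≤ (((fcellsA κ Φ t p D g f).s 1 : ℕ) : ℤ) := by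
  have h0 := true_size₀A κ Φ t p D g f hN hκ
  have h1 := true_size₁A κ Φ t p D g f hN hκ
  have hr' : 4 * (Neg.K κ : ℤ) * ((r : ℤ) + 2) ≤ (ML κ Φ t p D g : ℤ) := by exact_mod_cast hr
  have hKq : (1 : ℤ) ≤ Neg.Kq κ := by exact_mod_cast Neg.one_le_Kq κ
  have hKe : (Neg.K κ : ℤ) = 40 * Neg.Kq κ := by rw [Neg.K_eq]; push_cast; ring
  have hr0 : (0 : ℤ) ≤ r := by positivity
  rw [hKe] at hr'
  constructor <;> nlinarith

/-- Today's shapes (`Kq ≥ 1`): `6r + 11 ≤ s₀` and `14r + 27 ≤ s₁` under `4K(r+2) ≤ M_L`. [folklore] -/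
theorem sA_ge_of_floor' (κ : Consts) {V : Type} [DecidableEq V] [Countable V] {G : SimpleGraph V} [G.LocallyFinite] (Φ : PlanarSkeletonFrmFrom G) (t : V) (p : unitInterval) (D : Skelφ.StepI.DataNS V) (g : ℕ) (f : ℕ) (hN : EqNumL κ Φ t p D g f) (hκ : (hL κ Φ t p D g f).natAbs ≤ 10 * nL κ Φ t p D g f) {r : ℕ} (hr : 4 * Neg.K κ * (r + 2) ≤ ML κ Φ t p D g) :
    6 * (r : ℤ) + 11 ≤ (((fcellsA κ Φ t p D g f).s 0 : ℕ) : ℤ) ∧ 14 * (r : ℤ) + 27 ≤ (((fcellsA κ Φ t p D g f).s 1 : ℕ) : ℤ) := by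
  obtain ⟨h0, h1⟩ := sA_ge_of_floor κ Φ t p D g f hN hκ hr
  have hKq : (1 : ℤ) ≤ Neg.Kq κ := by exact_mod_cast Neg.one_le_Kq κ
  have hr0 : (0 : ℤ) ≤ r := by positivity
  constructor <;> nlinarith

end Cells

/-! ## §2 The (ζ′) cells at the box value of record -/

section AtValues

/-- **THE (ζ′) CELLS AT `g := gT`**: `Kq·(6·RA' + 11) ≤ s₀`, `Kq·(14·RA' + 27) ≤ s₁` (any width `f`). [folklore] -/
theorem cells_geTA (κ : Consts) {V : Type} [DecidableEq V] [Countable V] {G : SimpleGraph V} [G.LocallyFinite] (Φ : PlanarSkeletonFrmFrom G) (t : V) (p : unitInterval) (D : Skelφ.StepI.DataNS V) (mk : ℕ) (gx : Neg.FSlot) (f : ℕ) (hN : EqNumL κ Φ t p D (gT mk gx κ Φ t p D) f) (hκ : (hL κ Φ t p D (gT mk gx κ Φ t p D) f).natAbs ≤ 10 * nL κ Φ t p D (gT mk gx κ Φ t p D) f) :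
    (Neg.Kq κ : ℤ) * (6 * (RA' κ Φ t p D mk : ℤ) + 11) ≤ (((fcellsA κ Φ t p D (gT mk gx κ Φ t p D) f).s 0 : ℕ) : ℤ) ∧
      (Neg.Kq κ : ℤ) * (14 * (RA' κ Φ t p D mk : ℤ) + 27) ≤ (((fcellsA κ Φ t p D (gT mk gx κ Φ t p D) f).s 1 : ℕ) : ℤ) :=
  sA_ge_of_floor κ Φ t p D _ f hN hκ (ML_floorsT κ Φ t p D mk gx).1

/-- Today's shapes at `g := gT` for the (ζ′) cells: `6·RA' + 11 ≤ s₀`, `14·RA' + 27 ≤ s₁`. [folklore] -/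
theorem cells_geTA' (κ : Consts) {V : Type} [DecidableEq V] [Countable V] {G : SimpleGraph V} [G.LocallyFinite] (Φ : PlanarSkeletonFrmFrom G) (t : V) (p : unitInterval) (D : Skelφ.StepI.DataNS V) (mk : ℕ) (gx : Neg.FSlot) (f : ℕ) (hN : EqNumL κ Φ t p D (gT mk gx κ Φ t p D) f) (hκ : (hL κ Φ t p D (gT mk gx κ Φ t p D) f).natAbs ≤ 10 * nL κ Φ t p D (gT mk gx κ Φ t p D) f) :
    6 * (RA' κ Φ t p D mk : ℤ) + 11 ≤ (((fcellsA κ Φ t p D (gT mk gx κ Φ t p D) f).s 0 : ℕ) : ℤ) ∧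
      14 * (RA' κ Φ t p D mk : ℤ) + 27 ≤ (((fcellsA κ Φ t p D (gT mk gx κ Φ t p D) f).s 1 : ℕ) : ℤ) :=
  sA_ge_of_floor' κ Φ t p D _ f hN hκ (ML_floorsT κ Φ t p D mk gx).1

/-- **The (ζ′) fine radii at `g := gT`**: `K·Kq·(6RA'+11) ≤ r₀`, `K·Kq·(14RA'+27) ≤ r₁` (`r_i = K·s_i`). [folklore] -/
theorem r_geTA (κ : Consts) {V : Type} [DecidableEq V] [Countable V] {G : SimpleGraph V} [G.LocallyFinite] (Φ : PlanarSkeletonFrmFrom G) (t : V) (p : unitInterval) (D : Skelφ.StepI.DataNS V) (mk : ℕ) (gx : Neg.FSlot) (f : ℕ) (hN : EqNumL κ Φ t p D (gT mk gx κ Φ t p D) f) (hκ : (hL κ Φ t p D (gT mk gx κ Φ t p D) f).natAbs ≤ 10 * nL κ Φ t p D (gT mk gx κ Φ t p D) f) :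
    (Neg.K κ : ℤ) * ((Neg.Kq κ : ℤ) * (6 * (RA' κ Φ t p D mk : ℤ) + 11)) ≤ ((fcellsA κ Φ t p D (gT mk gx κ Φ t p D) f).r 0 : ℤ) ∧
      (Neg.K κ : ℤ) * ((Neg.Kq κ : ℤ) * (14 * (RA' κ Φ t p D mk : ℤ) + 27)) ≤ ((fcellsA κ Φ t p D (gT mk gx κ Φ t p D) f).r 1 : ℤ) := by
  obtain ⟨h0, h1⟩ := cells_geTA κ Φ t p D mk gx f hN hκ
  have hK : (0 : ℤ) ≤ Neg.K κ := Nat.cast_nonneg _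
  rw [(fcellsA κ Φ t p D (gT mk gx κ Φ t p D) f).r_eq 0, (fcellsA κ Φ t p D (gT mk gx κ Φ t p D) f).r_eq 1, (fcellsA_K κ Φ t p D (gT mk gx κ Φ t p D) f).1]
  exact ⟨mul_le_mul_of_nonneg_left h0 hK, mul_le_mul_of_nonneg_left h1 hK⟩

end AtValues

end KS

end NegB

end PlanarSkeletonFrmFrom

end Summit.CriticalPhenomena.PercolationContinuityZ3.Theorems.Transplant

end
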